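import Literature.NumberTheory.Automorphic.SplitOrthogonalSatakeOrbitSumBasis
import HarnessLib

/-!
# Treumann–Venkatesh's square-root-free Satake isomorphism for the split orthogonal group `O_N(J₀)`:
# over EVERY commutative ring `R` in which `q` is a unit (no `√q` required), the counting transform identifies
# `ℋ(O_N(J₀), K₀; R)` with the `(W, *)`-INVARIANT elements of `R[Λ]` (Treumann–Venkatesh 2016 §7.2 Thm. (i))

Topic `NumberTheory/Automorphic`; namespace `Literature.NumberTheory.Automorphic.HermitianLattice[.UnramifiedLocalConjDatum]`
(lane `lit-hodgefound`, Track 2 foundations; seat `lit-hodgefound-p11`, generation 49, row g49-#11).  Two DEFINITIONS with bodies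
(`orthogonalStarInvariants R N u`, the submodule of `(W,*)`-invariants; `countingSatakeLinearEquivStar`) + theorems; no named fact,
no instance, no notation.

## The print and the mathematics

[TreumannVenkatesh2016] §7.2: «we will require the following twisted action of the Weyl group `W_{0,v}` on `Â_v`:
`w * a = wa · √(Σ^*_G / wΣ^*_G)(q_v)` […] Note that `Σ^*/wΣ^*_G` is divisible by `2` in that cocharacter lattice; thus
`√(Σ^*_G/wΣ^*_G)(q_v)` makes sense»; THEOREM (i): «There is a natural isomorphism `ℋ(G_v, K_v) ⥲ (W_{0,v}, *)-invariant regular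
functions on `Â_v`»; proof: «`𝒮^* := δ^{-1/2} 𝒮` […] Since the `*`-action of `W_{0,v}` on `ℂ[X^*(Â_v)]` sends `χ` to
`w * χ = wχ · q_v^{⟨wΣ^*_G - Σ^*_G, wχ⟩/2}`, […] `𝒮^*` is an isomorphism onto the `(W_{0,v}, *)`-invariant subring […] To conclude
that `𝒮^*` is an isomorphism over `ℤ' = ℤ[q_v^{-1}]` …».

HERE `G = O_N(J₀) = U(id, J₀^{(N)})` — the case motivating the square-root-free formulation, since for odd `N` the modulus
`δ_B^{1/2} = q^{-Λ/2}` is not integral-valued on cocharacters (`Λ = orthogonalTwistExp` takes odd values) — `W = C_{S_N}(rev)` acting by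
`μ ↦ μ ∘ π`, `Λ(μ) = ⟨ν,μ⟩ - hs(μ)`, and `u ∈ Rˣ` a unit with `u = q` in `R` (NO square root).  An element `f ∈ R[ℤ^N]` supported on
the antisymmetric lattice `Λ` is `(W, *)`-INVARIANT iff `f_{μ∘π} = u^{(Λ(μ∘π)-Λ(μ))/2} f_μ` for all `π ∈ W` and all antisymmetric `μ`
— an honest integer power of the unit `u` by the parity theorem of g49-#10 (`two_dvd_orthogonalTwistExp_comp_sub`).  THEOREM: for
every commutative ring `R` and every unit `u = q`, the `(W,*)`-invariants coincide with the twisted invariants `𝒯^{O}_R(q)` of g49-#9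
(whose relations are one-sided with non-negative exponents and make sense over every `R`), hence with the image of the counting
transform: **`𝒮_1 : ℋ(O_N(J₀), K₀; R) ⥲ R[Λ]^{(W,*)}` whenever `q ∈ Rˣ`** — Treumann–Venkatesh's Theorem (i) over `ℤ[q^{-1}]`, over
`𝔽_ℓ` and `𝔽̄_ℓ` for `ℓ ∤ q`, etc., with no square root of `q` adjoined (contrast g49-#3 `satakeAlgEquivOrthogonal`, which needs
`u² = q`).

## What is formalised

* §1 `orthogonalStarInvariants R N u` (+ `mem_orthogonalStarInvariants_iff`).
* §2 **`orthogonalStarInvariants_eq_orthogonalTwistedSatakeTarget`** (`u = q` a unit ⇒ `R[Λ]^{(W,*)} = 𝒯^{O}_R(q)`).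
* §3 (with `hd : UnramifiedLocalConjDatum (RingHom.id K) ϖ`) **`range_satakeTransform_one_eq_orthogonalStarInvariants`** (THM. (i):
  `𝒮_1(ℋ(O_N(J₀), K₀; R)) = R[Λ]^{(W,*)}` for `q ∈ Rˣ`), `satakeTransform_one_mem_orthogonalStarInvariants`,
  **`countingSatakeLinearEquivStar : ℋ(O_N(J₀), K₀; R) ≃ₗ[R] R[Λ]^{(W,*)}`** (+ `_apply`), `mul_mem_orthogonalStarInvariants`,
  `range_satakeTransform_one_eq_orthogonalStarInvariants_of_isUnit` (hypothesis `IsUnit (q : R)`).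

## References
* [TreumannVenkatesh2016] D. Treumann, A. Venkatesh, *Functoriality, Smith theory, and the Brauer homomorphism*, Ann. of Math. 183
  (2016), §7.2 (twisted action (7.2.1), Theorem (i) and its proof).
* [HenniartVigneras2013] G. Henniart, M.-F. Vignéras, *A Satake isomorphism for representations modulo p of reductive groups over
  local fields*, J. reine angew. Math. 701 (2015), §7.11–§7.13 (the twisted action over `ℤ`).
* [GrossSatake1998] B. H. Gross, *On the Satake isomorphism* (1998), Prop. 3.6 («If `ρ ∈ X^•(T)` then […] `H_G ⊗ ℤ[q⁻¹] ≃ R(Ĝ) ⊗ ℤ[q⁻¹]`»).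
-/

noncomputable section

open scoped Valued WithZero Matrix MatrixGroups
open MonoidAlgebra Representation

namespace Literature.NumberTheory.Automorphic.HermitianLattice

open Literature.NumberTheory.Automorphic Literature.NumberTheory.Automorphic.CartanUnique
  Literature.NumberTheory.Automorphic.SymplecticCartan

variable {R : Type*} [CommRing R] {N : ℕ}

/-! ## §1 The `(W, *)`-invariants -/

section Star

variable (R N) in
/-- **The `(W, *)`-invariant elements of `R[Λ]`** for a unit `u ∈ Rˣ` (to be `u = q`): `f` supported on the antisymmetric
cocharacters with `f_{μ∘π} = u^{(Λ(μ∘π)-Λ(μ))/2} f_μ` for EVERY `π ∈ C_{S_N}(rev)` and every antisymmetric `μ` — invariance under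
Treumann–Venkatesh's twisted action `w * x^μ = q^{⟨wΣ^*-Σ^*, wμ⟩/2} x^{wμ}` (the exponent is an integer by
`two_dvd_orthogonalTwistExp_comp_sub`). [cite: TreumannVenkatesh2016, §7.2 (7.2.1), Thm. (i)] [cite: HenniartVigneras2013, §7.13] -/
def orthogonalStarInvariants (u : Rˣ) : Submodule R (AddMonoidAlgebra R (Fin N → ℤ)) where
  carrier := {f | (∀ μ : Fin N → ℤ, (¬ ∀ i, μ (Fin.rev i) = -μ i) → f.coeff μ = 0) ∧
    ∀ π : Equiv.Perm (Fin N), (∀ i, π (Fin.rev i) = Fin.rev (π i)) → ∀ μ : Fin N → ℤ, (∀ i, μ (Fin.rev i) = -μ i) →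
      f.coeff (μ ∘ π) = ((u ^ ((orthogonalTwistExp (μ ∘ π) - orthogonalTwistExp μ) / 2) : Rˣ) : R) * f.coeff μ}
  add_mem' {f g} hf hg := by
    refine ⟨fun μ hμ => ?_, fun π hπ μ hμ => ?_⟩
    · rw [AddMonoidAlgebra.coeff_add, Finsupp.add_apply, hf.1 μ hμ, hg.1 μ hμ, add_zero]
    · rw [AddMonoidAlgebra.coeff_add, Finsupp.add_apply, Finsupp.add_apply, hf.2 π hπ μ hμ, hg.2 π hπ μ hμ, mul_add]
  zero_mem' := ⟨fun μ _ => by rw [AddMonoidAlgebra.coeff_zero, Finsupp.zero_apply],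
    fun π _ μ _ => by rw [AddMonoidAlgebra.coeff_zero, Finsupp.zero_apply, Finsupp.zero_apply, mul_zero]⟩
  smul_mem' c {f} hf := by
    refine ⟨fun μ hμ => ?_, fun π hπ μ hμ => ?_⟩
    · rw [AddMonoidAlgebra.coeff_smul, Finsupp.smul_apply, hf.1 μ hμ, smul_zero]
    · rw [AddMonoidAlgebra.coeff_smul, Finsupp.smul_apply, Finsupp.smul_apply, hf.2 π hπ μ hμ, smul_eq_mul, smul_eq_mul,
        mul_left_comm]

/-- Membership in the `(W, *)`-invariants. [cite: TreumannVenkatesh2016, §7.2] -/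
theorem mem_orthogonalStarInvariants_iff (u : Rˣ) (f : AddMonoidAlgebra R (Fin N → ℤ)) :
    f ∈ orthogonalStarInvariants R N u ↔
      (∀ μ : Fin N → ℤ, (¬ ∀ i, μ (Fin.rev i) = -μ i) → f.coeff μ = 0) ∧
        ∀ π : Equiv.Perm (Fin N), (∀ i, π (Fin.rev i) = Fin.rev (π i)) → ∀ μ : Fin N → ℤ, (∀ i, μ (Fin.rev i) = -μ i) →
          f.coeff (μ ∘ π) = ((u ^ ((orthogonalTwistExp (μ ∘ π) - orthogonalTwistExp μ) / 2) : Rˣ) : R) * f.coeff μ :=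
  Iff.rfl

end Star

/-! ## §2 `R[Λ]^{(W,*)} = 𝒯^{O}_R(q)` when `q` is a unit -/

section Compare

omit [CommRing R] in
/-- Undoing a coordinate permutation: `(μ ∘ π) ∘ π⁻¹ = μ` (private plumbing). [folklore] -/
private theorem comp_perm_comp_inv'' (μ : Fin N → ℤ) (π : Equiv.Perm (Fin N)) : (μ ∘ ⇑π) ∘ ⇑π⁻¹ = μ := by
  rw [Function.comp_assoc, ← Equiv.Perm.coe_mul, mul_inv_cancel, Equiv.Perm.coe_one, Function.comp_id]

/-- `u^e = q^{e.toNat}` in `R` for a unit `u = q` and `e ≥ 0` (private plumbing). [folklore] -/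
private theorem units_zpow_eq_pow_toNat (u : Rˣ) {q : ℕ} (hu : (u : R) = q) {e : ℤ} (he : 0 ≤ e) :
    ((u ^ e : Rˣ) : R) = (q : R) ^ e.toNat := by
  obtain ⟨n, rfl⟩ := Int.eq_ofNat_of_zero_le he
  rw [zpow_natCast, Units.val_pow_eq_pow_val, hu, Int.toNat_natCast]

/-- **`R[Λ]^{(W,*)} = 𝒯^{O}_R(q)` for a unit `u = q`**: the two-sided `(W,*)`-invariance with integer powers of the unit `u` is
equivalent to g49-#9's one-sided relations with non-negative powers of `q` (the relation at `(μ∘π, π⁻¹)` supplies the other side;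
the exponents are even by g49-#10). [cite: TreumannVenkatesh2016, §7.2 Thm. (i) (proof)] [cite: HenniartVigneras2013, §7.13 Cor.] -/
theorem orthogonalStarInvariants_eq_orthogonalTwistedSatakeTarget (u : Rˣ) (q : ℕ) (hu : (u : R) = q) :
    orthogonalStarInvariants R N u = orthogonalTwistedSatakeTarget R N q := by
  ext f
  rw [mem_orthogonalStarInvariants_iff, mem_orthogonalTwistedSatakeTarget_iff]
  refine and_congr_right fun hsupp => ⟨fun h π hπ μ hle => ?_, fun h π hπ μ hμ => ?_⟩
  · -- `(W,*)`-invariant ⇒ twisted relation (non-negative exponent)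
    by_cases hμ : ∀ i, μ (Fin.rev i) = -μ i
    · rw [h π hπ μ hμ, units_zpow_eq_pow_toNat u hu (by omega)]
    · have hμ' : ¬ ∀ i, (μ ∘ ⇑π) (Fin.rev i) = -(μ ∘ ⇑π) i := fun h' => hμ fun i => by
        have e : π (π⁻¹ i) = i := by rw [Equiv.Perm.coe_inv, Equiv.apply_symm_apply]
        have := h' (π⁻¹ i)
        rwa [Function.comp_apply, Function.comp_apply, hπ, e] at this
      rw [hsupp μ hμ, hsupp _ hμ', mul_zero]
  · -- twisted relations ⇒ `(W,*)`-invariant: split on the sign of the exponent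
    have h2 := two_dvd_orthogonalTwistExp_comp_sub hμ hπ
    rcases le_or_gt (orthogonalTwistExp μ) (orthogonalTwistExp (μ ∘ π)) with hle | hlt
    · rw [h π hπ μ hle, units_zpow_eq_pow_toNat u hu (by omega)]
    · -- use the relation at `(μ∘π, π⁻¹)`: `f_μ = q^{(Λμ - Λ(μ∘π))/2} f_{μ∘π}`
      have hrel := h π⁻¹ (perm_inv_rev hπ) (μ ∘ π) (by rw [comp_perm_comp_inv'']; exact hlt.le)
      rw [comp_perm_comp_inv''] at hrel
      rw [hrel, ← mul_assoc, ← units_zpow_eq_pow_toNat u hu (show (0 : ℤ) ≤ _ by omega), ← Units.val_mul, ← zpow_add,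
        show (orthogonalTwistExp (μ ∘ ⇑π) - orthogonalTwistExp μ) / 2 +
          (orthogonalTwistExp μ - orthogonalTwistExp (μ ∘ ⇑π)) / 2 = 0 by omega, zpow_zero, Units.val_one, one_mul]

/-- With `IsUnit (q : R)`: the `(W,*)`-invariants for the unit `q` are `𝒯^{O}_R(q)`. [cite: TreumannVenkatesh2016, §7.2 Thm. (i)] -/
theorem orthogonalStarInvariants_unit_eq {q : ℕ} (hq : IsUnit ((q : ℕ) : R)) :
    orthogonalStarInvariants R N hq.unit = orthogonalTwistedSatakeTarget R N q :=
  orthogonalStarInvariants_eq_orthogonalTwistedSatakeTarget hq.unit q hq.unit_spec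

end Compare

/-! ## §3 Theorem (i) for `O_N(J₀)` over every `R` with `q ∈ Rˣ` -/

variable {K : Type*} [Field K] [Valued K ℤᵐ⁰] {ϖ : K}

namespace UnramifiedLocalConjDatum

variable [Finite 𝓀[K]]
  [IsHeckeTriple (⊤ : Submonoid (unitaryGroupOfForm (RingHom.id K) ((StdForm.antidiagonal N).over K)))
    (unitaryInt (RingHom.id K) ((StdForm.antidiagonal N).over K)) (unitaryInt (RingHom.id K) ((StdForm.antidiagonal N).over K))]

/-- **TREUMANN–VENKATESH THEOREM (i) FOR `O_N(J₀)`, SQUARE-ROOT-FREE: over every commutative ring `R` with a unit `u = q`, the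
image of the counting Satake transform `𝒮_1 : ℋ(O_N(J₀), K₀; R) → R[ℤ^N]` is exactly the module of `(W, *)`-invariants.**
[cite: TreumannVenkatesh2016, §7.2 Thm. (i)] [cite: GrossSatake1998, Prop. 3.6] -/
theorem range_satakeTransform_one_eq_orthogonalStarInvariants (hd : UnramifiedLocalConjDatum (RingHom.id K) ϖ) (u : Rˣ)
    (hu : (u : R) = Nat.card 𝓀[K]) :
    LinearMap.range ((hd.isIwasawaExponent (N := N)).satakeTransform (1 : Multiplicative (Fin N → ℤ) →* R)).toLinearMap =
      orthogonalStarInvariants R N u := by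
  rw [orthogonalStarInvariants_eq_orthogonalTwistedSatakeTarget u (Nat.card 𝓀[K]) hu,
    hd.range_satakeTransform_one_eq_orthogonalTwistedSatakeTarget]

/-- `IsUnit` form of Theorem (i) for `O_N(J₀)`: for every commutative ring `R` in which `q` is invertible.
[cite: TreumannVenkatesh2016, §7.2 Thm. (i)] -/
theorem range_satakeTransform_one_eq_orthogonalStarInvariants_of_isUnit (hd : UnramifiedLocalConjDatum (RingHom.id K) ϖ)
    (hq : IsUnit ((Nat.card 𝓀[K] : ℕ) : R)) :
    LinearMap.range ((hd.isIwasawaExponent (N := N)).satakeTransform (1 : Multiplicative (Fin N → ℤ) →* R)).toLinearMap =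
      orthogonalStarInvariants R N hq.unit :=
  hd.range_satakeTransform_one_eq_orthogonalStarInvariants hq.unit hq.unit_spec

/-- **`𝒮_1(T)` is `(W, *)`-invariant** for every `T ∈ ℋ(O_N(J₀), K₀; R)`, `u = q ∈ Rˣ`. [cite: TreumannVenkatesh2016, §7.2 Thm. (i)] -/
theorem satakeTransform_one_mem_orthogonalStarInvariants (hd : UnramifiedLocalConjDatum (RingHom.id K) ϖ) (u : Rˣ)
    (hu : (u : R) = Nat.card 𝓀[K])
    (T : heckeAlgebra R (unitaryGroupOfForm (RingHom.id K) ((StdForm.antidiagonal N).over K))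
      (unitaryInt (RingHom.id K) ((StdForm.antidiagonal N).over K))) :
    (hd.isIwasawaExponent (N := N)).satakeTransform 1 T ∈ orthogonalStarInvariants R N u := by
  rw [orthogonalStarInvariants_eq_orthogonalTwistedSatakeTarget u (Nat.card 𝓀[K]) hu]
  exact hd.satakeTransform_one_mem_orthogonalTwistedSatakeTarget T

/-- The `(W, *)`-invariants (`u = q ∈ Rˣ`) are closed under multiplication — the image of an algebra homomorphism («the
`(W_{0,v}, *)`-invariant subring»). [cite: TreumannVenkatesh2016, §7.2 Thm. (i)] -/
theorem mul_mem_orthogonalStarInvariants (hd : UnramifiedLocalConjDatum (RingHom.id K) ϖ) (u : Rˣ) (hu : (u : R) = Nat.card 𝓀[K])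
    {f g : AddMonoidAlgebra R (Fin N → ℤ)} (hf : f ∈ orthogonalStarInvariants R N u) (hg : g ∈ orthogonalStarInvariants R N u) :
    f * g ∈ orthogonalStarInvariants R N u := by
  rw [orthogonalStarInvariants_eq_orthogonalTwistedSatakeTarget u (Nat.card 𝓀[K]) hu] at hf hg ⊢
  exact hd.mul_mem_orthogonalTwistedSatakeTarget hf hg

/-- **THE SQUARE-ROOT-FREE SATAKE ISOMORPHISM `ℋ(O_N(J₀), K₀; R) ≃ₗ[R] R[Λ]^{(W,*)}` FOR EVERY COMMUTATIVE RING `R` WITH A UNIT `u = q`**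
(multiplicative as the restriction of `𝒮_1`). [cite: TreumannVenkatesh2016, §7.2 Thm. (i)] [cite: GrossSatake1998, Prop. 3.6] -/
def countingSatakeLinearEquivStar (hd : UnramifiedLocalConjDatum (RingHom.id K) ϖ) (u : Rˣ) (hu : (u : R) = Nat.card 𝓀[K]) :
    heckeAlgebra R (unitaryGroupOfForm (RingHom.id K) ((StdForm.antidiagonal N).over K))
        (unitaryInt (RingHom.id K) ((StdForm.antidiagonal N).over K)) ≃ₗ[R] orthogonalStarInvariants R N u :=
  hd.countingSatakeLinearEquivOrthogonal.trans
    (LinearEquiv.ofEq _ _ (orthogonalStarInvariants_eq_orthogonalTwistedSatakeTarget u (Nat.card 𝓀[K]) hu).symm)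

/-- The square-root-free Satake isomorphism is the counting transform `𝒮_1`. [cite: TreumannVenkatesh2016, §7.2] -/
@[simp] theorem countingSatakeLinearEquivStar_apply (hd : UnramifiedLocalConjDatum (RingHom.id K) ϖ) (u : Rˣ)
    (hu : (u : R) = Nat.card 𝓀[K])
    (T : heckeAlgebra R (unitaryGroupOfForm (RingHom.id K) ((StdForm.antidiagonal N).over K))
      (unitaryInt (RingHom.id K) ((StdForm.antidiagonal N).over K))) :
    ((hd.countingSatakeLinearEquivStar u hu T : orthogonalStarInvariants R N u) : AddMonoidAlgebra R (Fin N → ℤ)) =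
      (hd.isIwasawaExponent (N := N)).satakeTransform 1 T := rfl

end UnramifiedLocalConjDatum

end Literature.NumberTheory.Automorphic.HermitianLattice

end
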